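import Mathlib
import HarnessLib
import Summits.ValiantsHypothesis.ValiantsHypothesis.Theorems.SchenstedIndexPerThreeAnnihilator

/-!
# Route SchenstedIndex — the annihilator of `per_3`, II: `dim 𝔤𝔩(ℂ⁹)_{per_3} ≤ 4`

Part II of the computation of the Lie-algebra annihilator of `per_3` (part I:
`Theorems/SchenstedIndexPerThreeAnnihilator.lean`, monomial form `sum_monomial_eq_zero_of_mem_glAnn_perPoly_three`
and the cells in different rows and columns).  Here: cells in the SAME row (`Z_{(i,j),(i,c)} = 0`,
`j ≠ c`, from the three relations `∑_{i ≠ s} Z_{(i,j),(i,c)} = 0` read off the monomials with column `j`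
doubled — an odd cycle), the same column (transpose), hence ALL off-diagonal entries vanish
(`glAnn_perPoly_three_apply_eq_zero_of_ne`); then the six permutation relations on the diagonal and
the four-entry probe give **`finrank_glAnn_perPoly_three_le_four`**.  With
`sq_sub_one_le_finrank_glAnn_tracePow_three` (`dim 𝔤𝔩(ℂ⁹)_{tr X³} ≥ 8`) and the annihilator criterion
this yields `per_3 ∉ Δ(tr X_3³)` (border power-trace complexity of `per_3` at least `4`,
`Theorems/SchenstedIndexBorderPcPerThreeGeom.lean`).  Route-independent.

HONEST FRAMING: a finite computation about `per_3`; nothing here bears on `VP ≠ VNP`.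
-/

set_option linter.dupNamespace false

noncomputable section

namespace Summit.ValiantsHypothesis.ValiantsHypothesis.Theorems.SchenstedIndex

open MvPolynomial Matrix
open Literature.Computability.AlgebraicComplexity

/-! ## Cells in the same row or the same column -/

/-- Same row, columns `0 → 1`: `Z_((i,0),(i,1)) = 0` for `i = 0, 1, 2`. -/
theorem glAnn_perPoly_three_row_01 {Z : Matrix (Fin 3 × Fin 3) (Fin 3 × Fin 3) ℂ}
    (hZ : Z ∈ glAnn (perPoly (Fin 3) ℂ)) : Z (0, 0) (0, 1) = 0 ∧ Z (1, 0) (1, 1) = 0 ∧ Z (2, 0) (2, 1) = 0 := by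
  have hZ' := sum_monomial_eq_zero_of_mem_glAnn_perPoly_three hZ
  have e0 := congr_arg (coeff (Multiset.toFinsupp ({(0, 2), (1, 0), (2, 0)} : Multiset (Fin 3 × Fin 3)))) hZ'
  simp (config := { decide := true }) only [coeff_smul, coeff_add, coeff_monomial,
      coeff_zero, Fintype.sum_prod_type, Fin.sum_univ_three, smul_eq_mul,
      mul_one, mul_zero, add_zero, zero_add, if_true, if_false, Fin.isValue] at e0
  have e1 := congr_arg (coeff (Multiset.toFinsupp ({(0, 0), (1, 2), (2, 0)} : Multiset (Fin 3 × Fin 3)))) hZ'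
  simp (config := { decide := true }) only [coeff_smul, coeff_add, coeff_monomial,
      coeff_zero, Fintype.sum_prod_type, Fin.sum_univ_three, smul_eq_mul,
      mul_one, mul_zero, add_zero, zero_add, if_true, if_false, Fin.isValue] at e1
  have e2 := congr_arg (coeff (Multiset.toFinsupp ({(0, 0), (1, 0), (2, 2)} : Multiset (Fin 3 × Fin 3)))) hZ'
  simp (config := { decide := true }) only [coeff_smul, coeff_add, coeff_monomial,
      coeff_zero, Fintype.sum_prod_type, Fin.sum_univ_three, smul_eq_mul,
      mul_one, mul_zero, add_zero, zero_add, if_true, if_false, Fin.isValue] at e2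
  exact ⟨by linear_combination (e1 + e2 - e0) / 2, by linear_combination (e2 + e0 - e1) / 2, by linear_combination (e0 + e1 - e2) / 2⟩

/-- Same row, columns `0 → 2`: `Z_((i,0),(i,2)) = 0` for `i = 0, 1, 2`. -/
theorem glAnn_perPoly_three_row_02 {Z : Matrix (Fin 3 × Fin 3) (Fin 3 × Fin 3) ℂ}
    (hZ : Z ∈ glAnn (perPoly (Fin 3) ℂ)) : Z (0, 0) (0, 2) = 0 ∧ Z (1, 0) (1, 2) = 0 ∧ Z (2, 0) (2, 2) = 0 := by
  have hZ' := sum_monomial_eq_zero_of_mem_glAnn_perPoly_three hZ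
  have e0 := congr_arg (coeff (Multiset.toFinsupp ({(0, 1), (1, 0), (2, 0)} : Multiset (Fin 3 × Fin 3)))) hZ'
  simp (config := { decide := true }) only [coeff_smul, coeff_add, coeff_monomial,
      coeff_zero, Fintype.sum_prod_type, Fin.sum_univ_three, smul_eq_mul,
      mul_one, mul_zero, add_zero, zero_add, if_true, if_false, Fin.isValue] at e0
  have e1 := congr_arg (coeff (Multiset.toFinsupp ({(0, 0), (1, 1), (2, 0)} : Multiset (Fin 3 × Fin 3)))) hZ'
  simp (config := { decide := true }) only [coeff_smul, coeff_add, coeff_monomial,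
      coeff_zero, Fintype.sum_prod_type, Fin.sum_univ_three, smul_eq_mul,
      mul_one, mul_zero, add_zero, zero_add, if_true, if_false, Fin.isValue] at e1
  have e2 := congr_arg (coeff (Multiset.toFinsupp ({(0, 0), (1, 0), (2, 1)} : Multiset (Fin 3 × Fin 3)))) hZ'
  simp (config := { decide := true }) only [coeff_smul, coeff_add, coeff_monomial,
      coeff_zero, Fintype.sum_prod_type, Fin.sum_univ_three, smul_eq_mul,
      mul_one, mul_zero, add_zero, zero_add, if_true, if_false, Fin.isValue] at e2
  exact ⟨by linear_combination (e1 + e2 - e0) / 2, by linear_combination (e2 + e0 - e1) / 2, by linear_combination (e0 + e1 - e2) / 2⟩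

/-- Same row, columns `1 → 0`: `Z_((i,1),(i,0)) = 0` for `i = 0, 1, 2`. -/
theorem glAnn_perPoly_three_row_10 {Z : Matrix (Fin 3 × Fin 3) (Fin 3 × Fin 3) ℂ}
    (hZ : Z ∈ glAnn (perPoly (Fin 3) ℂ)) : Z (0, 1) (0, 0) = 0 ∧ Z (1, 1) (1, 0) = 0 ∧ Z (2, 1) (2, 0) = 0 := by
  have hZ' := sum_monomial_eq_zero_of_mem_glAnn_perPoly_three hZ
  have e0 := congr_arg (coeff (Multiset.toFinsupp ({(0, 2), (1, 1), (2, 1)} : Multiset (Fin 3 × Fin 3)))) hZ'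
  simp (config := { decide := true }) only [coeff_smul, coeff_add, coeff_monomial,
      coeff_zero, Fintype.sum_prod_type, Fin.sum_univ_three, smul_eq_mul,
      mul_one, mul_zero, add_zero, zero_add, if_true, if_false, Fin.isValue] at e0
  have e1 := congr_arg (coeff (Multiset.toFinsupp ({(0, 1), (1, 2), (2, 1)} : Multiset (Fin 3 × Fin 3)))) hZ'
  simp (config := { decide := true }) only [coeff_smul, coeff_add, coeff_monomial,
      coeff_zero, Fintype.sum_prod_type, Fin.sum_univ_three, smul_eq_mul,
      mul_one, mul_zero, add_zero, zero_add, if_true, if_false, Fin.isValue] at e1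
  have e2 := congr_arg (coeff (Multiset.toFinsupp ({(0, 1), (1, 1), (2, 2)} : Multiset (Fin 3 × Fin 3)))) hZ'
  simp (config := { decide := true }) only [coeff_smul, coeff_add, coeff_monomial,
      coeff_zero, Fintype.sum_prod_type, Fin.sum_univ_three, smul_eq_mul,
      mul_one, mul_zero, add_zero, zero_add, if_true, if_false, Fin.isValue] at e2
  exact ⟨by linear_combination (e1 + e2 - e0) / 2, by linear_combination (e2 + e0 - e1) / 2, by linear_combination (e0 + e1 - e2) / 2⟩

/-- Same row, columns `1 → 2`: `Z_((i,1),(i,2)) = 0` for `i = 0, 1, 2`. -/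
theorem glAnn_perPoly_three_row_12 {Z : Matrix (Fin 3 × Fin 3) (Fin 3 × Fin 3) ℂ}
    (hZ : Z ∈ glAnn (perPoly (Fin 3) ℂ)) : Z (0, 1) (0, 2) = 0 ∧ Z (1, 1) (1, 2) = 0 ∧ Z (2, 1) (2, 2) = 0 := by
  have hZ' := sum_monomial_eq_zero_of_mem_glAnn_perPoly_three hZ
  have e0 := congr_arg (coeff (Multiset.toFinsupp ({(0, 0), (1, 1), (2, 1)} : Multiset (Fin 3 × Fin 3)))) hZ'
  simp (config := { decide := true }) only [coeff_smul, coeff_add, coeff_monomial,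
      coeff_zero, Fintype.sum_prod_type, Fin.sum_univ_three, smul_eq_mul,
      mul_one, mul_zero, add_zero, zero_add, if_true, if_false, Fin.isValue] at e0
  have e1 := congr_arg (coeff (Multiset.toFinsupp ({(0, 1), (1, 0), (2, 1)} : Multiset (Fin 3 × Fin 3)))) hZ'
  simp (config := { decide := true }) only [coeff_smul, coeff_add, coeff_monomial,
      coeff_zero, Fintype.sum_prod_type, Fin.sum_univ_three, smul_eq_mul,
      mul_one, mul_zero, add_zero, zero_add, if_true, if_false, Fin.isValue] at e1
  have e2 := congr_arg (coeff (Multiset.toFinsupp ({(0, 1), (1, 1), (2, 0)} : Multiset (Fin 3 × Fin 3)))) hZ'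
  simp (config := { decide := true }) only [coeff_smul, coeff_add, coeff_monomial,
      coeff_zero, Fintype.sum_prod_type, Fin.sum_univ_three, smul_eq_mul,
      mul_one, mul_zero, add_zero, zero_add, if_true, if_false, Fin.isValue] at e2
  exact ⟨by linear_combination (e1 + e2 - e0) / 2, by linear_combination (e2 + e0 - e1) / 2, by linear_combination (e0 + e1 - e2) / 2⟩

/-- Same row, columns `2 → 0`: `Z_((i,2),(i,0)) = 0` for `i = 0, 1, 2`. -/
theorem glAnn_perPoly_three_row_20 {Z : Matrix (Fin 3 × Fin 3) (Fin 3 × Fin 3) ℂ}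
    (hZ : Z ∈ glAnn (perPoly (Fin 3) ℂ)) : Z (0, 2) (0, 0) = 0 ∧ Z (1, 2) (1, 0) = 0 ∧ Z (2, 2) (2, 0) = 0 := by
  have hZ' := sum_monomial_eq_zero_of_mem_glAnn_perPoly_three hZ
  have e0 := congr_arg (coeff (Multiset.toFinsupp ({(0, 1), (1, 2), (2, 2)} : Multiset (Fin 3 × Fin 3)))) hZ'
  simp (config := { decide := true }) only [coeff_smul, coeff_add, coeff_monomial,
      coeff_zero, Fintype.sum_prod_type, Fin.sum_univ_three, smul_eq_mul,
      mul_one, mul_zero, add_zero, zero_add, if_true, if_false, Fin.isValue] at e0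
  have e1 := congr_arg (coeff (Multiset.toFinsupp ({(0, 2), (1, 1), (2, 2)} : Multiset (Fin 3 × Fin 3)))) hZ'
  simp (config := { decide := true }) only [coeff_smul, coeff_add, coeff_monomial,
      coeff_zero, Fintype.sum_prod_type, Fin.sum_univ_three, smul_eq_mul,
      mul_one, mul_zero, add_zero, zero_add, if_true, if_false, Fin.isValue] at e1
  have e2 := congr_arg (coeff (Multiset.toFinsupp ({(0, 2), (1, 2), (2, 1)} : Multiset (Fin 3 × Fin 3)))) hZ'
  simp (config := { decide := true }) only [coeff_smul, coeff_add, coeff_monomial,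
      coeff_zero, Fintype.sum_prod_type, Fin.sum_univ_three, smul_eq_mul,
      mul_one, mul_zero, add_zero, zero_add, if_true, if_false, Fin.isValue] at e2
  exact ⟨by linear_combination (e1 + e2 - e0) / 2, by linear_combination (e2 + e0 - e1) / 2, by linear_combination (e0 + e1 - e2) / 2⟩

/-- Same row, columns `2 → 1`: `Z_((i,2),(i,1)) = 0` for `i = 0, 1, 2`. -/
theorem glAnn_perPoly_three_row_21 {Z : Matrix (Fin 3 × Fin 3) (Fin 3 × Fin 3) ℂ}
    (hZ : Z ∈ glAnn (perPoly (Fin 3) ℂ)) : Z (0, 2) (0, 1) = 0 ∧ Z (1, 2) (1, 1) = 0 ∧ Z (2, 2) (2, 1) = 0 := by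
  have hZ' := sum_monomial_eq_zero_of_mem_glAnn_perPoly_three hZ
  have e0 := congr_arg (coeff (Multiset.toFinsupp ({(0, 0), (1, 2), (2, 2)} : Multiset (Fin 3 × Fin 3)))) hZ'
  simp (config := { decide := true }) only [coeff_smul, coeff_add, coeff_monomial,
      coeff_zero, Fintype.sum_prod_type, Fin.sum_univ_three, smul_eq_mul,
      mul_one, mul_zero, add_zero, zero_add, if_true, if_false, Fin.isValue] at e0
  have e1 := congr_arg (coeff (Multiset.toFinsupp ({(0, 2), (1, 0), (2, 2)} : Multiset (Fin 3 × Fin 3)))) hZ'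
  simp (config := { decide := true }) only [coeff_smul, coeff_add, coeff_monomial,
      coeff_zero, Fintype.sum_prod_type, Fin.sum_univ_three, smul_eq_mul,
      mul_one, mul_zero, add_zero, zero_add, if_true, if_false, Fin.isValue] at e1
  have e2 := congr_arg (coeff (Multiset.toFinsupp ({(0, 2), (1, 2), (2, 0)} : Multiset (Fin 3 × Fin 3)))) hZ'
  simp (config := { decide := true }) only [coeff_smul, coeff_add, coeff_monomial,
      coeff_zero, Fintype.sum_prod_type, Fin.sum_univ_three, smul_eq_mul,
      mul_one, mul_zero, add_zero, zero_add, if_true, if_false, Fin.isValue] at e2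
  exact ⟨by linear_combination (e1 + e2 - e0) / 2, by linear_combination (e2 + e0 - e1) / 2, by linear_combination (e0 + e1 - e2) / 2⟩

/-- Same column, rows `0 → 1`: `Z_((0,j),(1,j)) = 0` for `j = 0, 1, 2`. -/
theorem glAnn_perPoly_three_col_01 {Z : Matrix (Fin 3 × Fin 3) (Fin 3 × Fin 3) ℂ}
    (hZ : Z ∈ glAnn (perPoly (Fin 3) ℂ)) : Z (0, 0) (1, 0) = 0 ∧ Z (0, 1) (1, 1) = 0 ∧ Z (0, 2) (1, 2) = 0 := by
  have hZ' := sum_monomial_eq_zero_of_mem_glAnn_perPoly_three hZ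
  have e0 := congr_arg (coeff (Multiset.toFinsupp ({(0, 1), (0, 2), (2, 0)} : Multiset (Fin 3 × Fin 3)))) hZ'
  simp (config := { decide := true }) only [coeff_smul, coeff_add, coeff_monomial,
      coeff_zero, Fintype.sum_prod_type, Fin.sum_univ_three, smul_eq_mul,
      mul_one, mul_zero, add_zero, zero_add, if_true, if_false, Fin.isValue] at e0
  have e1 := congr_arg (coeff (Multiset.toFinsupp ({(0, 0), (0, 2), (2, 1)} : Multiset (Fin 3 × Fin 3)))) hZ'
  simp (config := { decide := true }) only [coeff_smul, coeff_add, coeff_monomial,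
      coeff_zero, Fintype.sum_prod_type, Fin.sum_univ_three, smul_eq_mul,
      mul_one, mul_zero, add_zero, zero_add, if_true, if_false, Fin.isValue] at e1
  have e2 := congr_arg (coeff (Multiset.toFinsupp ({(0, 0), (0, 1), (2, 2)} : Multiset (Fin 3 × Fin 3)))) hZ'
  simp (config := { decide := true }) only [coeff_smul, coeff_add, coeff_monomial,
      coeff_zero, Fintype.sum_prod_type, Fin.sum_univ_three, smul_eq_mul,
      mul_one, mul_zero, add_zero, zero_add, if_true, if_false, Fin.isValue] at e2
  exact ⟨by linear_combination (e1 + e2 - e0) / 2, by linear_combination (e2 + e0 - e1) / 2, by linear_combination (e0 + e1 - e2) / 2⟩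

/-- Same column, rows `0 → 2`: `Z_((0,j),(2,j)) = 0` for `j = 0, 1, 2`. -/
theorem glAnn_perPoly_three_col_02 {Z : Matrix (Fin 3 × Fin 3) (Fin 3 × Fin 3) ℂ}
    (hZ : Z ∈ glAnn (perPoly (Fin 3) ℂ)) : Z (0, 0) (2, 0) = 0 ∧ Z (0, 1) (2, 1) = 0 ∧ Z (0, 2) (2, 2) = 0 := by
  have hZ' := sum_monomial_eq_zero_of_mem_glAnn_perPoly_three hZ
  have e0 := congr_arg (coeff (Multiset.toFinsupp ({(0, 1), (0, 2), (1, 0)} : Multiset (Fin 3 × Fin 3)))) hZ'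
  simp (config := { decide := true }) only [coeff_smul, coeff_add, coeff_monomial,
      coeff_zero, Fintype.sum_prod_type, Fin.sum_univ_three, smul_eq_mul,
      mul_one, mul_zero, add_zero, zero_add, if_true, if_false, Fin.isValue] at e0
  have e1 := congr_arg (coeff (Multiset.toFinsupp ({(0, 0), (0, 2), (1, 1)} : Multiset (Fin 3 × Fin 3)))) hZ'
  simp (config := { decide := true }) only [coeff_smul, coeff_add, coeff_monomial,
      coeff_zero, Fintype.sum_prod_type, Fin.sum_univ_three, smul_eq_mul,
      mul_one, mul_zero, add_zero, zero_add, if_true, if_false, Fin.isValue] at e1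
  have e2 := congr_arg (coeff (Multiset.toFinsupp ({(0, 0), (0, 1), (1, 2)} : Multiset (Fin 3 × Fin 3)))) hZ'
  simp (config := { decide := true }) only [coeff_smul, coeff_add, coeff_monomial,
      coeff_zero, Fintype.sum_prod_type, Fin.sum_univ_three, smul_eq_mul,
      mul_one, mul_zero, add_zero, zero_add, if_true, if_false, Fin.isValue] at e2
  exact ⟨by linear_combination (e1 + e2 - e0) / 2, by linear_combination (e2 + e0 - e1) / 2, by linear_combination (e0 + e1 - e2) / 2⟩

/-- Same column, rows `1 → 0`: `Z_((1,j),(0,j)) = 0` for `j = 0, 1, 2`. -/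
theorem glAnn_perPoly_three_col_10 {Z : Matrix (Fin 3 × Fin 3) (Fin 3 × Fin 3) ℂ}
    (hZ : Z ∈ glAnn (perPoly (Fin 3) ℂ)) : Z (1, 0) (0, 0) = 0 ∧ Z (1, 1) (0, 1) = 0 ∧ Z (1, 2) (0, 2) = 0 := by
  have hZ' := sum_monomial_eq_zero_of_mem_glAnn_perPoly_three hZ
  have e0 := congr_arg (coeff (Multiset.toFinsupp ({(1, 1), (1, 2), (2, 0)} : Multiset (Fin 3 × Fin 3)))) hZ'
  simp (config := { decide := true }) only [coeff_smul, coeff_add, coeff_monomial,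
      coeff_zero, Fintype.sum_prod_type, Fin.sum_univ_three, smul_eq_mul,
      mul_one, mul_zero, add_zero, zero_add, if_true, if_false, Fin.isValue] at e0
  have e1 := congr_arg (coeff (Multiset.toFinsupp ({(1, 0), (1, 2), (2, 1)} : Multiset (Fin 3 × Fin 3)))) hZ'
  simp (config := { decide := true }) only [coeff_smul, coeff_add, coeff_monomial,
      coeff_zero, Fintype.sum_prod_type, Fin.sum_univ_three, smul_eq_mul,
      mul_one, mul_zero, add_zero, zero_add, if_true, if_false, Fin.isValue] at e1
  have e2 := congr_arg (coeff (Multiset.toFinsupp ({(1, 0), (1, 1), (2, 2)} : Multiset (Fin 3 × Fin 3)))) hZ'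
  simp (config := { decide := true }) only [coeff_smul, coeff_add, coeff_monomial,
      coeff_zero, Fintype.sum_prod_type, Fin.sum_univ_three, smul_eq_mul,
      mul_one, mul_zero, add_zero, zero_add, if_true, if_false, Fin.isValue] at e2
  exact ⟨by linear_combination (e1 + e2 - e0) / 2, by linear_combination (e2 + e0 - e1) / 2, by linear_combination (e0 + e1 - e2) / 2⟩

/-- Same column, rows `1 → 2`: `Z_((1,j),(2,j)) = 0` for `j = 0, 1, 2`. -/
theorem glAnn_perPoly_three_col_12 {Z : Matrix (Fin 3 × Fin 3) (Fin 3 × Fin 3) ℂ}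
    (hZ : Z ∈ glAnn (perPoly (Fin 3) ℂ)) : Z (1, 0) (2, 0) = 0 ∧ Z (1, 1) (2, 1) = 0 ∧ Z (1, 2) (2, 2) = 0 := by
  have hZ' := sum_monomial_eq_zero_of_mem_glAnn_perPoly_three hZ
  have e0 := congr_arg (coeff (Multiset.toFinsupp ({(0, 0), (1, 1), (1, 2)} : Multiset (Fin 3 × Fin 3)))) hZ'
  simp (config := { decide := true }) only [coeff_smul, coeff_add, coeff_monomial,
      coeff_zero, Fintype.sum_prod_type, Fin.sum_univ_three, smul_eq_mul,
      mul_one, mul_zero, add_zero, zero_add, if_true, if_false, Fin.isValue] at e0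
  have e1 := congr_arg (coeff (Multiset.toFinsupp ({(0, 1), (1, 0), (1, 2)} : Multiset (Fin 3 × Fin 3)))) hZ'
  simp (config := { decide := true }) only [coeff_smul, coeff_add, coeff_monomial,
      coeff_zero, Fintype.sum_prod_type, Fin.sum_univ_three, smul_eq_mul,
      mul_one, mul_zero, add_zero, zero_add, if_true, if_false, Fin.isValue] at e1
  have e2 := congr_arg (coeff (Multiset.toFinsupp ({(0, 2), (1, 0), (1, 1)} : Multiset (Fin 3 × Fin 3)))) hZ'
  simp (config := { decide := true }) only [coeff_smul, coeff_add, coeff_monomial,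
      coeff_zero, Fintype.sum_prod_type, Fin.sum_univ_three, smul_eq_mul,
      mul_one, mul_zero, add_zero, zero_add, if_true, if_false, Fin.isValue] at e2
  exact ⟨by linear_combination (e1 + e2 - e0) / 2, by linear_combination (e2 + e0 - e1) / 2, by linear_combination (e0 + e1 - e2) / 2⟩

/-- Same column, rows `2 → 0`: `Z_((2,j),(0,j)) = 0` for `j = 0, 1, 2`. -/
theorem glAnn_perPoly_three_col_20 {Z : Matrix (Fin 3 × Fin 3) (Fin 3 × Fin 3) ℂ}
    (hZ : Z ∈ glAnn (perPoly (Fin 3) ℂ)) : Z (2, 0) (0, 0) = 0 ∧ Z (2, 1) (0, 1) = 0 ∧ Z (2, 2) (0, 2) = 0 := by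
  have hZ' := sum_monomial_eq_zero_of_mem_glAnn_perPoly_three hZ
  have e0 := congr_arg (coeff (Multiset.toFinsupp ({(1, 0), (2, 1), (2, 2)} : Multiset (Fin 3 × Fin 3)))) hZ'
  simp (config := { decide := true }) only [coeff_smul, coeff_add, coeff_monomial,
      coeff_zero, Fintype.sum_prod_type, Fin.sum_univ_three, smul_eq_mul,
      mul_one, mul_zero, add_zero, zero_add, if_true, if_false, Fin.isValue] at e0
  have e1 := congr_arg (coeff (Multiset.toFinsupp ({(1, 1), (2, 0), (2, 2)} : Multiset (Fin 3 × Fin 3)))) hZ'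
  simp (config := { decide := true }) only [coeff_smul, coeff_add, coeff_monomial,
      coeff_zero, Fintype.sum_prod_type, Fin.sum_univ_three, smul_eq_mul,
      mul_one, mul_zero, add_zero, zero_add, if_true, if_false, Fin.isValue] at e1
  have e2 := congr_arg (coeff (Multiset.toFinsupp ({(1, 2), (2, 0), (2, 1)} : Multiset (Fin 3 × Fin 3)))) hZ'
  simp (config := { decide := true }) only [coeff_smul, coeff_add, coeff_monomial,
      coeff_zero, Fintype.sum_prod_type, Fin.sum_univ_three, smul_eq_mul,
      mul_one, mul_zero, add_zero, zero_add, if_true, if_false, Fin.isValue] at e2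
  exact ⟨by linear_combination (e1 + e2 - e0) / 2, by linear_combination (e2 + e0 - e1) / 2, by linear_combination (e0 + e1 - e2) / 2⟩

/-- Same column, rows `2 → 1`: `Z_((2,j),(1,j)) = 0` for `j = 0, 1, 2`. -/
theorem glAnn_perPoly_three_col_21 {Z : Matrix (Fin 3 × Fin 3) (Fin 3 × Fin 3) ℂ}
    (hZ : Z ∈ glAnn (perPoly (Fin 3) ℂ)) : Z (2, 0) (1, 0) = 0 ∧ Z (2, 1) (1, 1) = 0 ∧ Z (2, 2) (1, 2) = 0 := by
  have hZ' := sum_monomial_eq_zero_of_mem_glAnn_perPoly_three hZ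
  have e0 := congr_arg (coeff (Multiset.toFinsupp ({(0, 0), (2, 1), (2, 2)} : Multiset (Fin 3 × Fin 3)))) hZ'
  simp (config := { decide := true }) only [coeff_smul, coeff_add, coeff_monomial,
      coeff_zero, Fintype.sum_prod_type, Fin.sum_univ_three, smul_eq_mul,
      mul_one, mul_zero, add_zero, zero_add, if_true, if_false, Fin.isValue] at e0
  have e1 := congr_arg (coeff (Multiset.toFinsupp ({(0, 1), (2, 0), (2, 2)} : Multiset (Fin 3 × Fin 3)))) hZ'
  simp (config := { decide := true }) only [coeff_smul, coeff_add, coeff_monomial,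
      coeff_zero, Fintype.sum_prod_type, Fin.sum_univ_three, smul_eq_mul,
      mul_one, mul_zero, add_zero, zero_add, if_true, if_false, Fin.isValue] at e1
  have e2 := congr_arg (coeff (Multiset.toFinsupp ({(0, 2), (2, 0), (2, 1)} : Multiset (Fin 3 × Fin 3)))) hZ'
  simp (config := { decide := true }) only [coeff_smul, coeff_add, coeff_monomial,
      coeff_zero, Fintype.sum_prod_type, Fin.sum_univ_three, smul_eq_mul,
      mul_one, mul_zero, add_zero, zero_add, if_true, if_false, Fin.isValue] at e2
  exact ⟨by linear_combination (e1 + e2 - e0) / 2, by linear_combination (e2 + e0 - e1) / 2, by linear_combination (e0 + e1 - e2) / 2⟩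

/-- **All off-diagonal entries of an annihilator of `per_3` vanish.** -/
theorem glAnn_perPoly_three_apply_eq_zero_of_ne
    {Z : Matrix (Fin 3 × Fin 3) (Fin 3 × Fin 3) ℂ} (hZ : Z ∈ glAnn (perPoly (Fin 3) ℂ))
    (a b : Fin 3 × Fin 3) (hab : a ≠ b) : Z a b = 0 := by
  obtain ⟨r01a, r01b, r01c⟩ := glAnn_perPoly_three_row_01 hZ
  obtain ⟨r02a, r02b, r02c⟩ := glAnn_perPoly_three_row_02 hZ
  obtain ⟨r10a, r10b, r10c⟩ := glAnn_perPoly_three_row_10 hZ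
  obtain ⟨r12a, r12b, r12c⟩ := glAnn_perPoly_three_row_12 hZ
  obtain ⟨r20a, r20b, r20c⟩ := glAnn_perPoly_three_row_20 hZ
  obtain ⟨r21a, r21b, r21c⟩ := glAnn_perPoly_three_row_21 hZ
  obtain ⟨c01a, c01b, c01c⟩ := glAnn_perPoly_three_col_01 hZ
  obtain ⟨c02a, c02b, c02c⟩ := glAnn_perPoly_three_col_02 hZ
  obtain ⟨c10a, c10b, c10c⟩ := glAnn_perPoly_three_col_10 hZ
  obtain ⟨c12a, c12b, c12c⟩ := glAnn_perPoly_three_col_12 hZ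
  obtain ⟨c20a, c20b, c20c⟩ := glAnn_perPoly_three_col_20 hZ
  obtain ⟨c21a, c21b, c21c⟩ := glAnn_perPoly_three_col_21 hZ
  obtain ⟨i, j⟩ := a
  obtain ⟨r, c⟩ := b
  by_cases hir : i = r
  · subst hir
    by_cases hjc : j = c
    · exact absurd (by rw [hjc]) hab
    · fin_cases i <;> fin_cases j <;> fin_cases c <;> first | exact absurd rfl hjc | assumption
  · by_cases hjc : j = c
    · subst hjc
      fin_cases i <;> fin_cases r <;> fin_cases j <;> first | exact absurd rfl hir | assumption
    · exact glAnn_perPoly_three_apply_eq_zero_of_ne_of_ne hZ (i, j) (r, c) hir hjc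

/-! ## The diagonal: permutation relations, and the dimension bound -/

/-- **The diagonal of an annihilator of `per_3` is determined by four entries**: with the six
permutation relations `∑_{a ∈ τ} Z_{aa} = 0` (coefficients of the permutation monomials), the entries
`Z_{00,00}, Z_{01,01}, Z_{02,02}, Z_{10,10}` determine `Z`. -/
theorem glAnn_perPoly_three_eq_zero_of_probe
    {Z : Matrix (Fin 3 × Fin 3) (Fin 3 × Fin 3) ℂ} (hZ : Z ∈ glAnn (perPoly (Fin 3) ℂ))
    (h00 : Z (0, 0) (0, 0) = 0) (h01 : Z (0, 1) (0, 1) = 0) (h02 : Z (0, 2) (0, 2) = 0)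
    (h10 : Z (1, 0) (1, 0) = 0) : Z = 0 := by
  have hZ' := sum_monomial_eq_zero_of_mem_glAnn_perPoly_three hZ
  have hd0 := congr_arg (coeff (Multiset.toFinsupp ({(0, 0), (1, 1), (2, 2)} : Multiset (Fin 3 × Fin 3)))) hZ'
  simp (config := { decide := true }) only [coeff_smul, coeff_add, coeff_monomial,
      coeff_zero, Fintype.sum_prod_type, Fin.sum_univ_three, smul_eq_mul,
      mul_one, mul_zero, add_zero, zero_add, if_true, if_false, Fin.isValue] at hd0
  have hd1 := congr_arg (coeff (Multiset.toFinsupp ({(0, 0), (1, 2), (2, 1)} : Multiset (Fin 3 × Fin 3)))) hZ'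
  simp (config := { decide := true }) only [coeff_smul, coeff_add, coeff_monomial,
      coeff_zero, Fintype.sum_prod_type, Fin.sum_univ_three, smul_eq_mul,
      mul_one, mul_zero, add_zero, zero_add, if_true, if_false, Fin.isValue] at hd1
  have hd2 := congr_arg (coeff (Multiset.toFinsupp ({(0, 1), (1, 0), (2, 2)} : Multiset (Fin 3 × Fin 3)))) hZ'
  simp (config := { decide := true }) only [coeff_smul, coeff_add, coeff_monomial,
      coeff_zero, Fintype.sum_prod_type, Fin.sum_univ_three, smul_eq_mul,
      mul_one, mul_zero, add_zero, zero_add, if_true, if_false, Fin.isValue] at hd2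
  have hd3 := congr_arg (coeff (Multiset.toFinsupp ({(0, 1), (1, 2), (2, 0)} : Multiset (Fin 3 × Fin 3)))) hZ'
  simp (config := { decide := true }) only [coeff_smul, coeff_add, coeff_monomial,
      coeff_zero, Fintype.sum_prod_type, Fin.sum_univ_three, smul_eq_mul,
      mul_one, mul_zero, add_zero, zero_add, if_true, if_false, Fin.isValue] at hd3
  have hd4 := congr_arg (coeff (Multiset.toFinsupp ({(0, 2), (1, 0), (2, 1)} : Multiset (Fin 3 × Fin 3)))) hZ'
  simp (config := { decide := true }) only [coeff_smul, coeff_add, coeff_monomial,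
      coeff_zero, Fintype.sum_prod_type, Fin.sum_univ_three, smul_eq_mul,
      mul_one, mul_zero, add_zero, zero_add, if_true, if_false, Fin.isValue] at hd4
  have z11 : Z (1, 1) (1, 1) = 0 := by linear_combination hd0 - hd2 - h00 + h01 + h10
  have z12 : Z (1, 2) (1, 2) = 0 := by linear_combination hd1 - hd4 - h00 + h02 + h10
  have z20 : Z (2, 0) (2, 0) = 0 := by linear_combination hd3 - hd1 + hd4 + h00 - h01 - h02 - h10
  have z21 : Z (2, 1) (2, 1) = 0 := by linear_combination hd4 - h02 - h10
  have z22 : Z (2, 2) (2, 2) = 0 := by linear_combination hd2 - h01 - h10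
  ext a b
  rw [Matrix.zero_apply]
  by_cases hab : a = b
  · subst hab
    obtain ⟨i, j⟩ := a
    fin_cases i <;> fin_cases j <;> assumption
  · exact glAnn_perPoly_three_apply_eq_zero_of_ne hZ a b hab

/-- **`dim 𝔤𝔩(ℂ⁹)_{per_3} ≤ 4`**: the four-entry probe is an injective linear map from the annihilator
to `ℂ⁴`. (Equality holds — the torus directions `x_(i,j) ↦ (α_i + β_j) x_(i,j)`, `∑α + ∑β = 0`, lie in
the annihilator — but only the upper bound is needed for the orbit-dimension argument.) -/
theorem finrank_glAnn_perPoly_three_le_four :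
    Module.finrank ℂ (glAnn (perPoly (Fin 3) ℂ)) ≤ 4 := by
  let probe : Matrix (Fin 3 × Fin 3) (Fin 3 × Fin 3) ℂ →ₗ[ℂ] (Fin 4 → ℂ) :=
    { toFun := fun Z => ![Z (0, 0) (0, 0), Z (0, 1) (0, 1), Z (0, 2) (0, 2), Z (1, 0) (1, 0)]
      map_add' := fun Z W => by
        ext k; fin_cases k <;> simp
      map_smul' := fun c Z => by
        ext k; fin_cases k <;> simp }
  have hinj : Function.Injective (probe.domRestrict (glAnn (perPoly (Fin 3) ℂ))) := by
    intro Z W hZW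
    apply Subtype.ext
    set D : Matrix (Fin 3 × Fin 3) (Fin 3 × Fin 3) ℂ :=
      (Z : Matrix (Fin 3 × Fin 3) (Fin 3 × Fin 3) ℂ) - (W : Matrix (Fin 3 × Fin 3) (Fin 3 × Fin 3) ℂ)
      with hD
    have hmem : D ∈ glAnn (perPoly (Fin 3) ℂ) := Submodule.sub_mem _ Z.2 W.2
    have hval : probe D = 0 := by
      rw [hD, map_sub, sub_eq_zero]
      exact hZW
    have h0 : D (0, 0) (0, 0) = 0 := by simpa [probe] using congr_fun hval 0
    have h1 : D (0, 1) (0, 1) = 0 := by simpa [probe] using congr_fun hval 1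
    have h2 : D (0, 2) (0, 2) = 0 := by simpa [probe] using congr_fun hval 2
    have h3 : D (1, 0) (1, 0) = 0 := by simpa [probe] using congr_fun hval 3
    exact sub_eq_zero.1 (glAnn_perPoly_three_eq_zero_of_probe hmem h0 h1 h2 h3)
  have h := LinearMap.finrank_le_finrank_of_injective hinj
  simpa using h

end Summit.ValiantsHypothesis.ValiantsHypothesis.Theorems.SchenstedIndex

end
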